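import Summits.QuantumFields.YangMills.Theorems.SmallCircleAnchorAnchorGapPolymerGasAtomRecursion

/-!
# Crux `AnchorGap` (stmt-QuantumFields-11141), line `registered` — RESUMMATION OF AN ATOM-PEELED
# RECURSION INTO THE HARD-CORE POLYMER GAS (step (G5f) of GREP's assembly, the pure algebra)

If set functions `Z`, `Kb` and atom weights `z1 ≠ 0` satisfy `Z ∅ = 1` and, for every non-empty `X`,
the ATOM-PEELED RECURSION `Z X = Σ_{Y ⊆ X, min X ∈ Y} Kb Y · Z (X ∖ Y)` with `Kb {a} = z1 a`, then
`Z X = (Π_{a∈X} z1 a) · Ξ_{𝒫 X}(Y ↦ Kb Y / Π_{a∈Y} z1 a)`, `𝒫 X = {Y ⊆ X : 2 ≤ |Y|}`, `Ξ` the hard-core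
(`polyInc`) polymer partition function — by induction on `|X|` against the atom recursion of `Ξ`
(✓`AtomGas.polymerPartitionFunction_atom_recursion`, p790535).  In GREP, `Z X = E(cov X 1)(Π_{b∈X} G b)`,
`z1 = Z1`, and `Kb Y` is the sum of the script terms with point set `Y` (so `Kb Y / Π Z1 = K Y`).
[folklore]; no definition, no named fact.
-/

set_option autoImplicit false

namespace Summit.QuantumFields.YangMills.Theorems.AnchorGap.Resum

open Finset Literature.Probability.LatticeModels

variable {β : Type} [DecidableEq β] [LinearOrder β]

/-- The sets through the minimum split into the singleton and the polymers (`2 ≤ |Y|`) through it.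
[folklore] -/
theorem sum_filter_min_mem_eq (X : Finset β) (hX : X.Nonempty) (f : Finset β → ℂ) :
    ∑ Y ∈ X.powerset.filter (fun Y => X.min' hX ∈ Y), f Y
      = f {X.min' hX} + ∑ Y ∈ (X.powerset.filter fun Y : Finset β => 2 ≤ Y.card).filter
          (fun Y => X.min' hX ∈ Y), f Y := by
  have hsplit : X.powerset.filter (fun Y => X.min' hX ∈ Y)
      = insert {X.min' hX} ((X.powerset.filter fun Y : Finset β => 2 ≤ Y.card).filter
          (fun Y => X.min' hX ∈ Y)) := by
    ext Y
    simp only [mem_filter, mem_powerset, mem_insert]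
    constructor
    · rintro ⟨hYX, hrY⟩
      by_cases h2 : 2 ≤ Y.card
      · exact Or.inr ⟨⟨hYX, h2⟩, hrY⟩
      · left
        have h1 : Y.card ≤ 1 := by omega
        exact (Finset.card_le_one.1 h1 |> fun h => Finset.eq_singleton_iff_unique_mem.2
          ⟨hrY, fun a ha => h a ha _ hrY⟩)
    · rintro (rfl | ⟨⟨hYX, -⟩, hrY⟩)
      · exact ⟨singleton_subset_iff.2 (min'_mem X hX), mem_singleton_self _⟩
      · exact ⟨hYX, hrY⟩
  rw [hsplit, sum_insert]
  simp only [mem_filter, mem_powerset, card_singleton]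
  omega

/-- **Resummation.** An atom-peeled recursion resums into the hard-core polymer gas of the sets of
size `≥ 2` with activities `Kb Y / Π_{a∈Y} z1 a`, relative to the free product `Π z1`. [folklore] -/
theorem eq_prod_mul_polymerPartitionFunction (Z Kb : Finset β → ℂ) (z1 : β → ℂ)
    (hz1 : ∀ a, z1 a ≠ 0) (hZ0 : Z ∅ = 1) (h1 : ∀ a, Kb {a} = z1 a)
    (hrec : ∀ (X : Finset β) (hX : X.Nonempty),
      Z X = ∑ Y ∈ X.powerset.filter (fun Y => X.min' hX ∈ Y), Kb Y * Z (X \ Y)) (X : Finset β) :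
    Z X = (∏ a ∈ X, z1 a) * polymerPartitionFunction polyInc (fun Y : Finset β => Kb Y / ∏ a ∈ Y, z1 a)
      (X.powerset.filter fun Y : Finset β => 2 ≤ Y.card) := by
  induction X using Finset.strongInduction with
  | H X ih =>
    rcases X.eq_empty_or_nonempty with rfl | hX
    · have he : (({∅} : Finset (Finset β)).filter fun Y : Finset β => 2 ≤ Y.card) = ∅ := by
        ext Y; simp only [mem_filter, mem_singleton, notMem_empty, iff_false, not_and, not_le]
        rintro rfl; simp
      rw [hZ0, prod_empty, powerset_empty, he, polymerPartitionFunction_empty, mul_one]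
    set r := X.min' hX with hr
    have hrX : r ∈ X := min'_mem X hX
    rw [hrec X hX, sum_filter_min_mem_eq X hX, h1,
      AtomGas.polymerPartitionFunction_atom_recursion _ X r, mul_add, mul_sum]
    congr 1
    · -- the singleton term
      rw [sdiff_singleton_eq_erase, ih (X.erase r) (erase_ssubset hrX), ← mul_assoc,
        mul_prod_erase X z1 hrX]
    · refine sum_congr rfl fun Y hY => ?_
      simp only [mem_filter, mem_powerset] at hY
      obtain ⟨⟨hYX, h2⟩, hrY⟩ := hY
      have hYne : Y.Nonempty := ⟨r, hrY⟩
      have hss : X \ Y ⊂ X := sdiff_ssubset hYX hYne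
      rw [ih (X \ Y) hss]
      have hprod : ∏ a ∈ X, z1 a = (∏ a ∈ Y, z1 a) * ∏ a ∈ X \ Y, z1 a := by
        rw [← prod_sdiff hYX, mul_comm]
      have hY0 : ∏ a ∈ Y, z1 a ≠ 0 := prod_ne_zero_iff.2 fun a _ => hz1 a
      rw [hprod]
      field_simp

end Summit.QuantumFields.YangMills.Theorems.AnchorGap.Resum
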